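import Summits.Ventures.PercRepro.RankLevelSetPlaneTenTraces

/-!
# PercRepro — the `10`-point rank-`4` sets of the `e`-free core are prime; `f(5) ≤ 19` (mine-4, gen 22)

The `f(5) ≤ 19` lever of the `q = 5` window (p7's S2 sub-claim): `RankLevelSetPlaneTen` gives `f(4) ≤ 10`
and the cover recursion `f(5) ≤ 2·10 + 1 = 21`; the missing step `21 → 19` is that a `10`-point cover side is
PRIME, so the prime-hyperplane lemma (K4) `ncard_le_of_prime_cover` kills it (`|G| ≤ 10 + 5 = 15`), and both
sides of every cover have `≤ 9` points. Ingredients in `RankLevelSetPlaneTenTraces`. The primality proof is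
uniform (no catalogue):

* **`false_of_traces`** — a `5`-point plane `B ⊆ H` (`r(H) ≤ 4`) whose points have covers `(F₁ y, F₂ y)`
  through two fixed lines disjoint from `B` cannot exist: either two `P`-traces or two `Q`-traces meet
  (`false_of_traces_meet`), or all traces are pairwise disjoint and `∑ (|P_y| + |Q_y|) ≥ 4 · 5` exceeds
  `2 · |B| = 10`;
* **`gprime_of_ten`** — a set `H ⊆ E` of rank `≤ 4` with `10` points is not the union of two proper `H`-closed
  subsets `A, B` (ranks `≤ 3`, `≤ 6` points each, `|A| + |B| ≥ 10`): a `6`-point side dies by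
  `false_of_six_side`; otherwise `|A| = |B| = 5`, disjoint; a prime side `A` would trap `B ∖ {y}` (`4` points)
  in a line, so `A` has a covering pair `(ℓ₁, ℓ₂)` and (K3′ `cover_pair_eq`) every cover of `y ∈ B` has sides
  through `ℓ₁` and `ℓ₂` — `false_of_traces`;
* **`ncard_le_nineteen_of_eRk_le_five_of_free`** — **`f(5) ≤ 19`**; **`card_le_nineteen_of_core`** /
  **`core_flat_five_le_nineteen`** — the `Core` / `flatsQ` bridge (the `card_le_ten_of_core` pattern);
* corollaries by the cover recursion: `f(6) ≤ 39` (`ncard_le_thirtynine_of_eRk_le_six_of_free`,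
  `card_le_thirtynine_of_core`) and the rank-`7` core on `≤ 79` elements
  (`ncard_ground_le_seventynine_of_eRank_le_seven_of_free`).
Axioms: standard.
-/

open scoped Matroid

namespace PercRepro

namespace ThmN

variable {α : Type}

/-- **The trace contradiction**: a `5`-point plane `B ⊆ H` (`r(H) ≤ 4`) whose points have covers `(F₁ y, F₂ y)`
through two fixed lines `m₁, m₂` disjoint from `B` cannot exist — either two `P`-traces or two `Q`-traces
meet (`false_of_traces_meet`), or all traces are pairwise disjoint and `∑ (|P_y| + |Q_y|) ≥ 4 · 5` exceeds
`2 · |B|`. -/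
theorem false_of_traces (M : Matroid α) [M.Finite]
    (hfree : ∀ e ∈ M.E, ∃ A ⊆ M.E \ {e}, e ∉ M.closure A ∧ e ∉ M.closure ((M.E \ {e}) \ A))
    {H B m₁ m₂ : Set α} (hH : H ⊆ M.E) (hr : M.eRk H ≤ 4) (hB : GClosed M H B) (hrB : M.eRk B ≤ 3)
    (hB5 : B.ncard = 5)
    (hm₁ : GClosed M H m₁) (h2₁ : 2 ≤ m₁.ncard) (hm₁B : ∀ z, z ∈ m₁ → z ∈ B → False)
    (hm₂ : GClosed M H m₂) (h2₂ : 2 ≤ m₂.ncard) (hm₂B : ∀ z, z ∈ m₂ → z ∈ B → False)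
    (F₁ F₂ : α → Set α)
    (hF : ∀ y ∈ B, GClosed M H (F₁ y) ∧ GClosed M H (F₂ y) ∧ y ∉ F₁ y ∧ y ∉ F₂ y ∧
      H \ {y} ⊆ F₁ y ∪ F₂ y ∧ m₁ ⊆ F₁ y ∧ m₂ ⊆ F₂ y) : False := by
  classical
  have hHfin : H.Finite := M.ground_finite.subset hH
  have hBH : B ⊆ H := hB.1
  have hBfin : B.Finite := hHfin.subset hBH
  have hF' : ∀ y ∈ B, GClosed M H (F₂ y) ∧ GClosed M H (F₁ y) ∧ y ∉ F₂ y ∧ y ∉ F₁ y ∧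
      H \ {y} ⊆ F₂ y ∪ F₁ y ∧ m₂ ⊆ F₂ y ∧ m₁ ⊆ F₁ y := by
    intro y hy
    obtain ⟨h1, h2, h3, h4, h5, h6, h7⟩ := hF y hy
    exact ⟨h2, h1, h4, h3, by rw [Set.union_comm]; exact h5, h7, h6⟩
  by_cases hP : ∃ y ∈ B, ∃ y' ∈ B, y ≠ y' ∧ ∃ z, z ∈ F₁ y ∩ B ∧ z ∈ F₁ y' ∩ B
  · obtain ⟨y, hy, y', hy', hne, z, hz, hz'⟩ := hP
    exact false_of_traces_meet M hfree hH hr hB hrB hB5 hm₁ h2₁ hm₁B hm₂ h2₂ hm₂B F₁ F₂ hF hy hy'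
      hne hz hz'
  by_cases hQ : ∃ y ∈ B, ∃ y' ∈ B, y ≠ y' ∧ ∃ z, z ∈ F₂ y ∩ B ∧ z ∈ F₂ y' ∩ B
  · obtain ⟨y, hy, y', hy', hne, z, hz, hz'⟩ := hQ
    exact false_of_traces_meet M hfree hH hr hB hrB hB5 hm₂ h2₂ hm₂B hm₁ h2₁ hm₁B F₂ F₁ hF' hy hy'
      hne hz hz'
  push Not at hP hQ
  -- counting: pairwise disjoint traces, `4 ≤ |P_y| + |Q_y|` for each of the `5` points
  set s : Finset α := hBfin.toFinset with hs
  set t : α → Finset α := fun y => hBfin.toFinset.filter (fun z => z ∈ F₁ y) with ht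
  set t' : α → Finset α := fun y => hBfin.toFinset.filter (fun z => z ∈ F₂ y) with ht'
  have hmem : ∀ y, y ∈ s ↔ y ∈ B := fun y => by rw [hs]; exact Set.Finite.mem_toFinset hBfin
  have hmemt : ∀ y z, z ∈ t y ↔ z ∈ B ∧ z ∈ F₁ y := fun y z => by
    rw [ht]; simp only [Finset.mem_filter, Set.Finite.mem_toFinset]
  have hmemt' : ∀ y z, z ∈ t' y ↔ z ∈ B ∧ z ∈ F₂ y := fun y z => by
    rw [ht']; simp only [Finset.mem_filter, Set.Finite.mem_toFinset]
  have hs5 : s.card = 5 := by rw [hs, ← Set.ncard_eq_toFinset_card B hBfin]; exact hB5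
  have hpd : (s : Set α).PairwiseDisjoint t := by
    intro y hy y' hy' hne
    show Disjoint (t y) (t y')
    rw [Finset.disjoint_left]
    intro z hz hz'
    obtain ⟨hzB, hzF⟩ := (hmemt y z).1 hz
    obtain ⟨-, hzF'⟩ := (hmemt y' z).1 hz'
    exact hP y ((hmem y).1 (Finset.mem_coe.1 hy)) y' ((hmem y').1 (Finset.mem_coe.1 hy')) hne z
      ⟨hzF, hzB⟩ ⟨hzF', hzB⟩
  have hpd' : (s : Set α).PairwiseDisjoint t' := by
    intro y hy y' hy' hne
    show Disjoint (t' y) (t' y')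
    rw [Finset.disjoint_left]
    intro z hz hz'
    obtain ⟨hzB, hzF⟩ := (hmemt' y z).1 hz
    obtain ⟨-, hzF'⟩ := (hmemt' y' z).1 hz'
    exact hQ y ((hmem y).1 (Finset.mem_coe.1 hy)) y' ((hmem y').1 (Finset.mem_coe.1 hy')) hne z
      ⟨hzF, hzB⟩ ⟨hzF', hzB⟩
  have hsumP : ∑ y ∈ s, (t y).card ≤ 5 := by
    rw [← Finset.card_biUnion hpd, ← hs5]
    apply Finset.card_le_card
    intro z hz
    obtain ⟨y, -, hz⟩ := Finset.mem_biUnion.1 hz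
    exact (hmem z).2 ((hmemt y z).1 hz).1
  have hsumQ : ∑ y ∈ s, (t' y).card ≤ 5 := by
    rw [← Finset.card_biUnion hpd', ← hs5]
    apply Finset.card_le_card
    intro z hz
    obtain ⟨y, -, hz⟩ := Finset.mem_biUnion.1 hz
    exact (hmem z).2 ((hmemt' y z).1 hz).1
  have h4 : ∀ y ∈ s, 4 ≤ (t y).card + (t' y).card := by
    intro y hy
    have hyB : y ∈ B := (hmem y).1 hy
    obtain ⟨-, -, -, -, hcovy, -, -⟩ := hF y hyB
    have hcovB : B \ {y} ⊆ (F₁ y ∩ B) ∪ (F₂ y ∩ B) := by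
      intro z hz
      rcases hcovy ⟨hBH hz.1, hz.2⟩ with h | h
      · exact Or.inl ⟨h, hz.1⟩
      · exact Or.inr ⟨h, hz.1⟩
    have hcoe : ((t y : Finset α) : Set α) = F₁ y ∩ B := by
      ext z
      rw [Finset.mem_coe, hmemt]
      exact ⟨fun h => ⟨h.2, h.1⟩, fun h => ⟨h.2, h.1⟩⟩
    have hcoe' : ((t' y : Finset α) : Set α) = F₂ y ∩ B := by
      ext z
      rw [Finset.mem_coe, hmemt']
      exact ⟨fun h => ⟨h.2, h.1⟩, fun h => ⟨h.2, h.1⟩⟩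
    have h1 : (B \ {y}).ncard + 1 = B.ncard := Set.ncard_sdiff_singleton_add_one hyB hBfin
    have h2 : (B \ {y}).ncard ≤ (F₁ y ∩ B).ncard + (F₂ y ∩ B).ncard :=
      (Set.ncard_le_ncard hcovB ((hBfin.subset Set.inter_subset_right).union
        (hBfin.subset Set.inter_subset_right))).trans (Set.ncard_union_le _ _)
    rw [← Set.ncard_coe_finset (t y), ← Set.ncard_coe_finset (t' y), hcoe, hcoe']
    omega
  have hsum : ∑ y ∈ s, 4 ≤ ∑ y ∈ s, ((t y).card + (t' y).card) := Finset.sum_le_sum h4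
  rw [Finset.sum_add_distrib, Finset.sum_const, hs5, smul_eq_mul] at hsum
  omega

/-- **THE `10`-POINT PRIMALITY LEMMA**: in a finite matroid in which every element has an `e`-free partition, a
set `H ⊆ E` of rank `≤ 4` with exactly `10` points is prime — not the union of two proper `H`-closed subsets. -/
theorem gprime_of_ten (M : Matroid α) [M.Finite]
    (hfree : ∀ e ∈ M.E, ∃ A ⊆ M.E \ {e}, e ∉ M.closure A ∧ e ∉ M.closure ((M.E \ {e}) \ A))
    {H : Set α} (hH : H ⊆ M.E) (hr : M.eRk H ≤ 4) (h10 : H.ncard = 10) : GPrime M H H := by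
  classical
  intro A B hA hB hAH hBH hcov
  by_contra hne
  push Not at hne
  obtain ⟨hAne, hBne⟩ := hne
  have hHfin : H.Finite := M.ground_finite.subset hH
  have hAfin : A.Finite := hHfin.subset hAH
  have hBfin : B.Finite := hHfin.subset hBH
  have hrA : M.eRk A ≤ 3 := eRk_le_three_of_gclosed_of_ne M hH hr hA hAne
  have hrB : M.eRk B ≤ 3 := eRk_le_three_of_gclosed_of_ne M hH hr hB hBne
  have hA6 : A.ncard ≤ 6 := ncard_le_six_of_eRk_le_three_of_free M hfree (hAH.trans hH) hrA
  have hB6 : B.ncard ≤ 6 := ncard_le_six_of_eRk_le_three_of_free M hfree (hBH.trans hH) hrB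
  have hsum : 10 ≤ A.ncard + B.ncard := by
    calc 10 = H.ncard := h10.symm
      _ ≤ (A ∪ B).ncard := Set.ncard_le_ncard hcov (hAfin.union hBfin)
      _ ≤ A.ncard + B.ncard := Set.ncard_union_le A B
  -- no `6`-point side, so `|A| = |B| = 5` and `A ∩ B = ∅`
  have hA6' : A.ncard ≠ 6 := fun h => false_of_six_side M hfree hH hr h10 hA hB hcov hBne h
  have hB6' : B.ncard ≠ 6 := fun h =>
    false_of_six_side M hfree hH hr h10 hB hA (by rw [Set.union_comm]; exact hcov) hAne h
  have hA5 : A.ncard = 5 := by omega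
  have hB5 : B.ncard = 5 := by omega
  have hdisj : ∀ z, z ∈ A → z ∈ B → False := by
    intro z hzA hzB
    have h1 := Set.ncard_inter_add_ncard_union A B hAfin hBfin
    have h2 : 10 ≤ (A ∪ B).ncard := by
      calc 10 = H.ncard := h10.symm
        _ ≤ (A ∪ B).ncard := Set.ncard_le_ncard hcov (hAfin.union hBfin)
    have h3 : 0 < (A ∩ B).ncard :=
      (Set.ncard_pos (hAfin.subset Set.inter_subset_left)).2 ⟨z, hzA, hzB⟩
    omega
  have hrA3 : (3 : ℕ∞) ≤ M.eRk A :=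
    three_le_eRk_of_four_le_ncard_of_free M hfree (hAH.trans hH) (by omega)
  -- no side of the cover of a point `y ∈ B` contains `A`
  have htrace : ∀ y ∈ B, ∀ C D : Set α, GClosed M H C → GClosed M H D → y ∉ C → y ∉ D →
      H \ {y} ⊆ C ∪ D → C ∩ A ≠ A := by
    intro y hy C D hC hD hyC hyD hcovCD heq
    have hyH : y ∈ H := hBH hy
    have hAC : A ⊆ C := fun z hz => (show z ∈ C ∩ A by rw [heq]; exact hz).1
    have hrC : M.eRk C ≤ 3 := eRk_le_three_of_gclosed_of_notMem M hH hr hC hyH hyC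
    have hCA : C ⊆ A := subset_of_gclosed_of_eRk_le M hH hA hC.1 hAC (hrC.trans hrA3)
    have hsub : B \ {y} ⊆ D ∩ B := by
      intro z hz
      rcases hcovCD ⟨hBH hz.1, hz.2⟩ with h | h
      · exact absurd hz.1 (hdisj z (hCA h))
      · exact ⟨h, hz.1⟩
    have hne : D ∩ B ≠ B := by
      intro h
      have : y ∈ D ∩ B := by rw [h]; exact hy
      exact hyD this.1
    obtain ⟨-, h3⟩ :=
      line_of_gclosed_ssubset M hfree hH hB hrB (hD.inter hB) Set.inter_subset_right hne
    have h4 : (B \ {y}).ncard + 1 = B.ncard := Set.ncard_sdiff_singleton_add_one hy hBfin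
    have := Set.ncard_le_ncard hsub (hBfin.subset Set.inter_subset_right)
    omega
  -- `A` is not prime in `H`
  have hnp : ¬ GPrime M H A := by
    intro hp
    obtain ⟨y, hy⟩ : B.Nonempty := by
      rw [Set.nonempty_iff_ne_empty]
      intro h
      rw [h, Set.ncard_empty] at hB5
      omega
    obtain ⟨G₁, G₂, hG₁, hG₂, hyG₁, hyG₂, hcy⟩ := exists_cover_of_free M hfree hH (hBH hy)
    have hcovA : A ⊆ (G₁ ∩ A) ∪ (G₂ ∩ A) := by
      intro z hz
      have hzy : z ∉ ({y} : Set α) := by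
        intro h
        rw [Set.mem_singleton_iff] at h
        exact hdisj z hz (h ▸ hy)
      rcases hcy ⟨hAH hz, hzy⟩ with h | h
      · exact Or.inl ⟨h, hz⟩
      · exact Or.inr ⟨h, hz⟩
    rcases hp (G₁ ∩ A) (G₂ ∩ A) (hG₁.inter hA) (hG₂.inter hA) Set.inter_subset_right
        Set.inter_subset_right hcovA with h | h
    · exact htrace y hy G₁ G₂ hG₁ hG₂ hyG₁ hyG₂ hcy h
    · exact htrace y hy G₂ G₁ hG₂ hG₁ hyG₂ hyG₁ (by rw [Set.union_comm]; exact hcy) h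
  -- the covering pair `(ℓ₁, ℓ₂)` of `A`: `ℓ₁` a `3`-point line, `ℓ₂ ⊇ A ∖ ℓ₁`
  obtain ⟨ℓ₁, ℓ₂, hℓ₁, hℓ₂, hℓ₁A, hℓ₂A, hℓcov, hℓ₁ne, hℓ₂ne, hℓ₁3⟩ : ∃ ℓ₁ ℓ₂ : Set α,
      GClosed M H ℓ₁ ∧ GClosed M H ℓ₂ ∧ ℓ₁ ⊆ A ∧ ℓ₂ ⊆ A ∧ A ⊆ ℓ₁ ∪ ℓ₂ ∧ ℓ₁ ≠ A ∧ ℓ₂ ≠ A ∧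
      ℓ₁.ncard = 3 := by
    unfold GPrime at hnp
    push Not at hnp
    obtain ⟨A', B', hA', hB', hA'A, hB'A, hcov', hA'ne, hB'ne⟩ := hnp
    obtain ⟨-, hA'3⟩ := line_of_gclosed_ssubset M hfree hH hA hrA hA' hA'A hA'ne
    obtain ⟨-, hB'3⟩ := line_of_gclosed_ssubset M hfree hH hA hrA hB' hB'A hB'ne
    have h5 : 5 ≤ A'.ncard + B'.ncard := by
      calc 5 = A.ncard := hA5.symm
        _ ≤ (A' ∪ B').ncard :=
          Set.ncard_le_ncard hcov' ((hAfin.subset hA'A).union (hAfin.subset hB'A))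
        _ ≤ A'.ncard + B'.ncard := Set.ncard_union_le _ _
    rcases Nat.lt_or_ge A'.ncard 3 with hlt | hge
    · exact ⟨B', A', hB', hA', hB'A, hA'A, by rw [Set.union_comm]; exact hcov', hB'ne, hA'ne,
        by omega⟩
    · exact ⟨A', B', hA', hB', hA'A, hB'A, hcov', hA'ne, hB'ne, by omega⟩
  obtain ⟨hr₁, -⟩ := line_of_gclosed_ssubset M hfree hH hA hrA hℓ₁ hℓ₁A hℓ₁ne
  obtain ⟨hr₂, -⟩ := line_of_gclosed_ssubset M hfree hH hA hrA hℓ₂ hℓ₂A hℓ₂ne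
  have hAℓ : A \ ℓ₁ ⊆ ℓ₂ := by
    intro z hz
    rcases hℓcov hz.1 with h | h
    · exact absurd h hz.2
    · exact h
  have hAℓ2 : (A \ ℓ₁).ncard + ℓ₁.ncard = A.ncard := Set.ncard_sdiff_add_ncard_of_subset hℓ₁A hAfin
  have hℓ₂2 : 2 ≤ ℓ₂.ncard := by
    have := Set.ncard_le_ncard hAℓ (hAfin.subset hℓ₂A)
    omega
  -- every `y ∈ B` has a cover `(G₁ y, G₂ y)` with `ℓ₁ ⊆ G₁ y`, `ℓ₂ ⊆ G₂ y` (K3′)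
  have hcovy : ∀ y : α, ∃ G₁ G₂ : Set α, y ∈ B → (GClosed M H G₁ ∧ GClosed M H G₂ ∧ y ∉ G₁ ∧
      y ∉ G₂ ∧ H \ {y} ⊆ G₁ ∪ G₂ ∧ ℓ₁ ⊆ G₁ ∧ ℓ₂ ⊆ G₂) := by
    intro y
    by_cases hy : y ∈ B
    · have hyH : y ∈ H := hBH hy
      obtain ⟨G₁, G₂, hG₁, hG₂, hyG₁, hyG₂, hcy⟩ := exists_cover_of_free M hfree hH hyH
      have hcy' : H \ {y} ⊆ G₂ ∪ G₁ := by rw [Set.union_comm]; exact hcy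
      have htr₁ := htrace y hy G₁ G₂ hG₁ hG₂ hyG₁ hyG₂ hcy
      have htr₂ := htrace y hy G₂ G₁ hG₂ hG₁ hyG₂ hyG₁ hcy'
      obtain ⟨hr₁', -⟩ :=
        line_of_gclosed_ssubset M hfree hH hA hrA (hG₁.inter hA) Set.inter_subset_right htr₁
      obtain ⟨hr₂', -⟩ :=
        line_of_gclosed_ssubset M hfree hH hA hrA (hG₂.inter hA) Set.inter_subset_right htr₂
      have hcovA : A ⊆ (G₁ ∩ A) ∪ (G₂ ∩ A) := by
        intro z hz
        have hzy : z ∉ ({y} : Set α) := by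
          intro h
          rw [Set.mem_singleton_iff] at h
          exact hdisj z hz (h ▸ hy)
        rcases hcy ⟨hAH hz, hzy⟩ with h | h
        · exact Or.inl ⟨h, hz⟩
        · exact Or.inr ⟨h, hz⟩
      rcases cover_pair_eq M hfree hH hAH hA5 hℓ₁ hℓ₁A hℓ₁3 hr₁ hℓ₂ hr₂ hAℓ (hG₁.inter hA)
          (hG₂.inter hA) hr₁' hr₂' hcovA with ⟨e₁, e₂⟩ | ⟨e₁, e₂⟩
      · exact ⟨G₁, G₂, fun _ => ⟨hG₁, hG₂, hyG₁, hyG₂, hcy,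
          fun w hw => (show w ∈ G₁ ∩ A by rw [e₁]; exact hw).1,
          fun w hw => (show w ∈ G₂ ∩ A by rw [e₂]; exact hw).1⟩⟩
      · exact ⟨G₂, G₁, fun _ => ⟨hG₂, hG₁, hyG₂, hyG₁, hcy',
          fun w hw => (show w ∈ G₂ ∩ A by rw [e₂]; exact hw).1,
          fun w hw => (show w ∈ G₁ ∩ A by rw [e₁]; exact hw).1⟩⟩
    · exact ⟨∅, ∅, fun h => absurd h hy⟩
  choose G₁ G₂ hGy using hcovy
  exact false_of_traces M hfree hH hr hB hrB hB5 hℓ₁ (by omega)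
    (fun z hz hzB => hdisj z (hℓ₁A hz) hzB) hℓ₂ hℓ₂2 (fun z hz hzB => hdisj z (hℓ₂A hz) hzB)
    G₁ G₂ hGy

/-- **`f(5) ≤ 19`**: in a finite matroid in which every element has an `e`-free partition, every set `G ⊆ E` of
rank `≤ 5` has at most `19` points — a `10`-point cover side is prime and (K4) gives `|G| ≤ 15`, so both sides
have `≤ 9` points and `|G| ≤ 9 + 9 + 1`. -/
theorem ncard_le_nineteen_of_eRk_le_five_of_free (M : Matroid α) [M.Finite]
    (hfree : ∀ e ∈ M.E, ∃ A ⊆ M.E \ {e}, e ∉ M.closure A ∧ e ∉ M.closure ((M.E \ {e}) \ A))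
    {G : Set α} (hG : G ⊆ M.E) (hr : M.eRk G ≤ 5) : G.ncard ≤ 19 := by
  by_contra h19
  push Not at h19
  have hGfin : G.Finite := M.ground_finite.subset hG
  obtain ⟨x, hx⟩ : G.Nonempty := by
    rw [Set.nonempty_iff_ne_empty]
    intro h
    rw [h, Set.ncard_empty] at h19
    omega
  obtain ⟨H₁, H₂, hH₁, hH₂, hxH₁, hxH₂, hcov⟩ := exists_cover_of_free M hfree hG hx
  have hside : ∀ C : Set α, GClosed M G C → x ∉ C → M.eRk C ≤ 4 ∧ C.ncard ≤ 10 := by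
    intro C hC hxC
    have h1 : M.eRk C < (5 : ℕ∞) := lt_of_lt_of_le (eRk_lt_of_gclosed_ssubset M hG hC hx hxC) hr
    have h5 : (5 : ℕ∞) = 4 + 1 := by norm_num
    rw [h5] at h1
    have hr4 : M.eRk C ≤ 4 := Order.le_of_lt_add_one h1
    exact ⟨hr4, ncard_le_ten_of_eRk_le_four_of_free M hfree (hC.1.trans hG) hr4⟩
  obtain ⟨hr₁, h₁10⟩ := hside H₁ hH₁ hxH₁
  obtain ⟨hr₂, h₂10⟩ := hside H₂ hH₂ hxH₂
  -- a `10`-point side is prime: (K4) gives `|G| ≤ 15`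
  have hten : ∀ C D : Set α, GClosed M G C → GClosed M G D → x ∉ C → x ∉ D → G \ {x} ⊆ C ∪ D →
      M.eRk C ≤ 4 → C.ncard = 10 → False := by
    intro C D hC hD hxC hxD hcovCD hrC hC10
    have hp : GPrime M G C := gprime_of_self hC (gprime_of_ten M hfree (hC.1.trans hG) hrC hC10)
    have hrC4 : (4 : ℕ∞) ≤ M.eRk C :=
      four_le_eRk_of_seven_le_ncard_of_free M hfree (hC.1.trans hG) (by omega)
    have hrk : M.eRk G ≤ M.eRk C + 1 := by
      calc M.eRk G ≤ 5 := hr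
        _ = 4 + 1 := by norm_num
        _ ≤ M.eRk C + 1 := add_le_add hrC4 le_rfl
    have := ncard_le_of_prime_cover M hfree hG hx hC hD hxC hxD hcovCD hp hrk (r := 5)
      (by exact_mod_cast hr)
    omega
  have hH₁9 : H₁.ncard ≤ 9 := by
    by_contra h
    push Not at h
    exact hten H₁ H₂ hH₁ hH₂ hxH₁ hxH₂ hcov hr₁ (by omega)
  have hH₂9 : H₂.ncard ≤ 9 := by
    by_contra h
    push Not at h
    exact hten H₂ H₁ hH₂ hH₁ hxH₂ hxH₁ (by rw [Set.union_comm]; exact hcov) hr₂ (by omega)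
  have hGx : (G \ {x}).ncard + 1 = G.ncard := Set.ncard_sdiff_singleton_add_one hx hGfin
  have hH₁fin : H₁.Finite := hGfin.subset hH₁.1
  have hH₂fin : H₂.Finite := hGfin.subset hH₂.1
  have hunion : (G \ {x}).ncard ≤ H₁.ncard + H₂.ncard :=
    (Set.ncard_le_ncard hcov (hH₁fin.union hH₂fin)).trans (Set.ncard_union_le _ _)
  omega

/-- **`card_le_nineteen_of_core`**: on a core matroid (`NightThree.Core M p`) every rank-`5` flat
`F ∈ flatsQ M 5` has at most `19` points — `f(5) ≤ 19` in the vocabulary of `card_le_ten_of_core`. -/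
theorem card_le_nineteen_of_core {M : Matroid α} [M.Finite] {p : ℕ} (hc : NightThree.Core M p)
    {F : Finset α} (hF : F ∈ PerFlat.flatsQ M 5) : F.card ≤ 19 := by
  obtain ⟨hFE, _, hrk⟩ := PerFlat.mem_flatsQ.1 hF
  have hFE' : (F : Set α) ⊆ M.E := by rw [← ThmH.coe_gr M]; exact Finset.coe_subset.2 hFE
  have := ncard_le_nineteen_of_eRk_le_five_of_free M hc.2.2.2 hFE' (le_of_eq hrk)
  rwa [Set.ncard_coe_finset] at this

/-- `f(5) ≤ 19` on the core in the binder form of `core_flat_four_le_ten`. -/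
theorem core_flat_five_le_nineteen :
    ∀ {β : Type} [DecidableEq β] (M : Matroid β) [M.Finite] {p : ℕ}, NightThree.Core M p →
      ∀ F ∈ PerFlat.flatsQ M 5, F.card ≤ 19 := by
  intro β _ M _ p hc F hF
  exact card_le_nineteen_of_core hc hF

/-- Rank-`6` sets of the `e`-free core have at most `39` points (`f(6) ≤ 2·19 + 1`, sharpening `43`). -/
theorem ncard_le_thirtynine_of_eRk_le_six_of_free (M : Matroid α) [M.Finite]
    (hfree : ∀ e ∈ M.E, ∃ A ⊆ M.E \ {e}, e ∉ M.closure A ∧ e ∉ M.closure ((M.E \ {e}) \ A))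
    {F : Set α} (hF : F ⊆ M.E) (hr : M.eRk F ≤ 6) : F.ncard ≤ 39 :=
  ncard_le_two_mul_add_one_of_free M hfree (k := 5) (B := 19)
    (fun _ hY hrY => ncard_le_nineteen_of_eRk_le_five_of_free M hfree hY hrY) F hF hr

/-- `f(6) ≤ 39` on a core matroid: every rank-`6` flat `F ∈ flatsQ M 6` has at most `39` points. -/
theorem card_le_thirtynine_of_core {M : Matroid α} [M.Finite] {p : ℕ} (hc : NightThree.Core M p)
    {F : Finset α} (hF : F ∈ PerFlat.flatsQ M 6) : F.card ≤ 39 := by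
  obtain ⟨hFE, _, hrk⟩ := PerFlat.mem_flatsQ.1 hF
  have hFE' : (F : Set α) ⊆ M.E := by rw [← ThmH.coe_gr M]; exact Finset.coe_subset.2 hFE
  have := ncard_le_thirtynine_of_eRk_le_six_of_free M hc.2.2.2 hFE' (le_of_eq hrk)
  rwa [Set.ncard_coe_finset] at this

/-- **The rank-`7` `e`-free core lives on at most `79` elements** (sharpening `87`). -/
theorem ncard_ground_le_seventynine_of_eRank_le_seven_of_free (M : Matroid α) [M.Finite]
    (hfree : ∀ e ∈ M.E, ∃ A ⊆ M.E \ {e}, e ∉ M.closure A ∧ e ∉ M.closure ((M.E \ {e}) \ A))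
    (hR : M.eRank ≤ 7) : M.E.ncard ≤ 79 :=
  ncard_le_two_mul_add_one_of_free M hfree (k := 6) (B := 39)
    (fun _ hY hrY => ncard_le_thirtynine_of_eRk_le_six_of_free M hfree hY hrY) M.E subset_rfl
    (by rw [← M.eRank_def]; exact hR)

end ThmN

end PercRepro
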